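import Literature.MathematicalPhysics.QuantumFieldTheory.Balaban1983to89.B16Eq191PrintedActivity
import Summits.QuantumFields.BalabanUV.T4Continuum.Spine.NE7.QLaQuotientFormat

/-!
# Spine/NE7/QLaQuotientFormatB16 — NODE S's LAW HALF (W-fmt@1) AT THE B16 FOLD's TYPED INTEGRAL OPERATIONS: for every
# operation family that IS integration against fibre kernels (`B16Eq191PrintedActivity.IntegralOps Op μ` — the typed form of
# [Balaban1989LargeFieldII] (1.71) `𝐓′_k(X)`), the `t`-discrepancy of the log of a quotient of two rider-tilted applications
# `Op S (e^{tF}·ρ₁) φ ∕ Op S (e^{tF}·ρ₂) φ` is at most `2|t|·s`, FIBREWISE in the exterior configuration `φ`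

Cell `pub-balaban-gaps` (YM blitz Y1, track G2, seat `ne7`, generation 14); text of record
`run/shared/lean/pub/pub-balaban-gaps/ne/NE7.md` (census row R81 of this generation).  Fifty-fourth `Spine/NE7/` file; 0 `def`,
0 sorry; [folklore] real analysis of one positive quotient (file 37) composed BY NAME with the B16 fold's operation format.

WHY.  File 37 (`QLaQuotientFormat`, generation 10) stated NODE S's law half against [Balaban1989LargeFieldI] (0.3) AS TYPED
(`B15.RData`: restricted integrals `IntOver Z′` as abstract functionals, with the HYPOTHESIS `hInt` that `IntOver Z′` is
integration against a measure).  Since then the `lit-balaban` B16 fold typed the (1.90)–(1.91) activities WITH BODY over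
operations `Op : Finset LF → (Φ → ℂ) →+ (Φ → ℂ)` and the predicate `IntegralOps Op μ` — «on integrable functions the operation
is integration against the kernel», `Op S f φ = ∫ ψ, f ψ ∂(μ S φ)`, a FINITE measure `μ S φ` on the field configurations depending
on the exterior configuration `φ` (what (1.71) p. 378 displays for `𝐓′_k(X)`: Gaussian and Haar integrals with characteristic
functions) — and PROVED the printed exchange (1.91) for such operations (`exchange191_of_integralOps`).  That predicate IS
file 37's `hInt`, fibrewise; so NODE S's per-entry bound can be keyed to it directly: this file does so.  For any integral
operation family, any index `S`, any exterior `φ`, two non-negative `μ S φ`-integrable real pieces `ρ₁, ρ₂` with positive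
integrals and ONE real rider `F` with `|F − F₀| ≤ s` `μ S φ`-a.e.:
`|log(Re Op S(e^{tF}ρ₁)φ ∕ Re Op S(e^{tF}ρ₂)φ) − log(Re Op S(ρ₁)φ ∕ Re Op S(ρ₂)φ)| ≤ 2|t|·s` (§2; the operations are
`ℂ`-valued, the pieces real, so the applications are real numbers cast to `ℂ`, §1).  With NODE S's range bound for the rider
(`s = Cd·wt·(θ²)ⁿ` on print-kind domains, files 51–53) this is the per-entry input of the census END FACE
(`QLaCensus.qla_of_logQuotient`) for every ledger whose entries are quotients of `IntegralOps` applications.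

HONEST FRAMING.  A FORMAT lemma: it says nothing about WHICH operations, pieces and riders Bałaban's `R` ∕ `𝐓′_k` produce
(NODE 00 Stage 5: the (2.18) [III] densities, the (0.3)∕(0.5) quotients, (F-rider), the per-entry identity (α), the instance
(γ)), nor that the B16 fold's `IntegralOps` instances are those of the cell's tori.  Real analysis + `integral_ofReal`;
nothing of Bałaban's asserted beyond print; (QL-a) NOT IN PRINT ([Balaban1989LargeFieldII] p. 356 defers observables); NE7 NOT
proved; spine 0∕9; one fixed finite T⁴ — NOT ℝ⁴, NOT infinite volume, NOT a mass gap, NOT Clay.  No classification word moves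
(R10).
-/

noncomputable section

open MeasureTheory

namespace Summit.QuantumFields.BalabanUV.T4Continuum.Spine.NE7

open Literature.MathematicalPhysics.QuantumFieldTheory.Balaban1983to89
open Literature.MathematicalPhysics.QuantumFieldTheory.Balaban1983to89.B16Eq191PrintedActivity (IntegralOps)

variable {LF Φ : Type*} [MeasurableSpace Φ]
variable {Op : Finset LF → (Φ → ℂ) →+ (Φ → ℂ)} {μ : Finset LF → Φ → Measure Φ}

/-! ## §1 Integral operations applied to real integrands are real integrals -/

/-- An integral operation applied to (the complex cast of) a real `μ S φ`-integrable function is the cast of its real integral: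
`Op S (↑f) φ = ↑(∫ f dμ_{S,φ})`. [folklore] -/
theorem integralOps_apply_ofReal (hOp : IntegralOps Op μ) (S : Finset LF) (φ : Φ) {f : Φ → ℝ}
    (hf : Integrable f (μ S φ)) : Op S (fun ψ => (f ψ : ℂ)) φ = ((∫ ψ, f ψ ∂(μ S φ) : ℝ) : ℂ) := by
  have hint : Integrable (fun ψ => (f ψ : ℂ)) (μ S φ) := hf.ofReal
  rw [hOp.apply_eq S φ _ hint, integral_complex_ofReal]

/-- … so its real part IS the real integral. [folklore] -/
theorem re_integralOps_apply_ofReal (hOp : IntegralOps Op μ) (S : Finset LF) (φ : Φ) {f : Φ → ℝ}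
    (hf : Integrable f (μ S φ)) : (Op S (fun ψ => (f ψ : ℂ)) φ).re = ∫ ψ, f ψ ∂(μ S φ) := by
  rw [integralOps_apply_ofReal hOp S φ hf, Complex.ofReal_re]

/-! ## §2 The law half of W-fmt@1 at `IntegralOps` -/

/-- **NODE S's LAW HALF AT THE B16 FOLD's INTEGRAL OPERATIONS** (file 37's `abs_log_tiltedQuotient_sub_le` keyed to
`B16Eq191PrintedActivity.IntegralOps`): for an integral operation family `Op` with fibre kernels `μ` ([Balaban1989LargeFieldII]
(1.71) as typed by the `lit-balaban` fold), an index `S`, an exterior configuration `φ`, two real pieces `ρ₁, ρ₂ ≥ 0`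
`μ S φ`-a.e., `μ S φ`-integrable, with positive integrals, and ONE real rider `F` with `|F − F₀| ≤ s` `μ S φ`-a.e.:
`|log(Re Op S(e^{tF}ρ₁)φ ∕ Re Op S(e^{tF}ρ₂)φ) − log(Re Op S(ρ₁)φ ∕ Re Op S(ρ₂)φ)| ≤ 2·|t|·s` — the constant `tF₀` cancels between
numerator and denominator, only the rider's RANGE enters (second order at the flat exterior by criticality; `s = Cd·wt·(θ²)ⁿ` on the
print-kind domains of files 51–53). [folklore] -/
theorem abs_log_quotient_sub_le_of_integralOps (hOp : IntegralOps Op μ) (S : Finset LF) (φ : Φ) {ρ₁ ρ₂ F : Φ → ℝ}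
    (hρ₁ : Integrable ρ₁ (μ S φ)) (hρ₂ : Integrable ρ₂ (μ S φ)) (hρ₁0 : 0 ≤ᵐ[μ S φ] ρ₁) (hρ₂0 : 0 ≤ᵐ[μ S φ] ρ₂)
    (hI₁ : 0 < ∫ ψ, ρ₁ ψ ∂(μ S φ)) (hI₂ : 0 < ∫ ψ, ρ₂ ψ ∂(μ S φ)) (hF : AEStronglyMeasurable F (μ S φ)) {F₀ s : ℝ}
    (hb : ∀ᵐ ψ ∂(μ S φ), |F ψ - F₀| ≤ s) (t : ℝ) :
    |Real.log ((Op S (fun ψ => ((Real.exp (t * F ψ) * ρ₁ ψ : ℝ) : ℂ)) φ).re /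
          (Op S (fun ψ => ((Real.exp (t * F ψ) * ρ₂ ψ : ℝ) : ℂ)) φ).re)
        - Real.log ((Op S (fun ψ => (ρ₁ ψ : ℂ)) φ).re / (Op S (fun ψ => (ρ₂ ψ : ℂ)) φ).re)| ≤ 2 * (|t| * s) := by
  rw [re_integralOps_apply_ofReal hOp S φ (integrable_exp_mul_mul hρ₁ hF hb t),
    re_integralOps_apply_ofReal hOp S φ (integrable_exp_mul_mul hρ₂ hF hb t),
    re_integralOps_apply_ofReal hOp S φ hρ₁, re_integralOps_apply_ofReal hOp S φ hρ₂]
  exact abs_log_tiltedQuotient_sub_le (μ S φ) hρ₁ hρ₂ hρ₁0 hρ₂0 hI₁ hI₂ hF hb t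

/-- **… AND FOR `log(1 + quotient)`** — the form in which one renormalised component enters the exponentiated sum (0.5) when the
restricted integrals factorise over components (file 37's `abs_log_one_add_sub_le`): the same `2|t|·s`. [folklore] -/
theorem abs_log_one_add_quotient_sub_le_of_integralOps (hOp : IntegralOps Op μ) (S : Finset LF) (φ : Φ) {ρ₁ ρ₂ F : Φ → ℝ}
    (hρ₁ : Integrable ρ₁ (μ S φ)) (hρ₂ : Integrable ρ₂ (μ S φ)) (hρ₁0 : 0 ≤ᵐ[μ S φ] ρ₁) (hρ₂0 : 0 ≤ᵐ[μ S φ] ρ₂)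
    (hI₁ : 0 < ∫ ψ, ρ₁ ψ ∂(μ S φ)) (hI₂ : 0 < ∫ ψ, ρ₂ ψ ∂(μ S φ)) (hF : AEStronglyMeasurable F (μ S φ)) {F₀ s : ℝ}
    (hb : ∀ᵐ ψ ∂(μ S φ), |F ψ - F₀| ≤ s) (t : ℝ) :
    |Real.log (1 + (Op S (fun ψ => ((Real.exp (t * F ψ) * ρ₁ ψ : ℝ) : ℂ)) φ).re /
          (Op S (fun ψ => ((Real.exp (t * F ψ) * ρ₂ ψ : ℝ) : ℂ)) φ).re)
        - Real.log (1 + (Op S (fun ψ => (ρ₁ ψ : ℂ)) φ).re / (Op S (fun ψ => (ρ₂ ψ : ℂ)) φ).re)| ≤ 2 * (|t| * s) := by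
  have h := abs_log_quotient_sub_le_of_integralOps hOp S φ hρ₁ hρ₂ hρ₁0 hρ₂0 hI₁ hI₂ hF hb t
  rw [re_integralOps_apply_ofReal hOp S φ (integrable_exp_mul_mul hρ₁ hF hb t),
    re_integralOps_apply_ofReal hOp S φ (integrable_exp_mul_mul hρ₂ hF hb t),
    re_integralOps_apply_ofReal hOp S φ hρ₁, re_integralOps_apply_ofReal hOp S φ hρ₂] at h ⊢
  obtain ⟨hp₁, _⟩ := abs_log_integral_exp_mul_mul_sub_le hρ₁ hρ₁0 hI₁ hF hb t
  obtain ⟨hp₂, _⟩ := abs_log_integral_exp_mul_mul_sub_le hρ₂ hρ₂0 hI₂ hF hb t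
  exact abs_log_one_add_sub_le (div_pos hp₁ hp₂) (div_pos hI₁ hI₂) h

/-- **FIBREWISE FAMILY FORM** — the shape a ledger of components delivers: if for EVERY exterior configuration `φ` the pieces and
the rider satisfy the hypotheses with the SAME range bound `s` (a support statement: the fibre kernels `μ S φ` charge only
configurations on which the rider stays within `s` of its flat value), then the `t`-discrepancy of the fibrewise constant
`φ ↦ log(Re Op S(e^{tF}ρ₁)φ ∕ Re Op S(e^{tF}ρ₂)φ)` is `≤ 2|t|·s` uniformly in `φ`. [folklore] -/
theorem abs_log_quotient_sub_le_of_integralOps_uniform (hOp : IntegralOps Op μ) (S : Finset LF) {ρ₁ ρ₂ F : Φ → ℝ} {F₀ s : ℝ}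
    (hρ₁ : ∀ φ, Integrable ρ₁ (μ S φ)) (hρ₂ : ∀ φ, Integrable ρ₂ (μ S φ)) (hρ₁0 : ∀ φ, 0 ≤ᵐ[μ S φ] ρ₁)
    (hρ₂0 : ∀ φ, 0 ≤ᵐ[μ S φ] ρ₂) (hI₁ : ∀ φ, 0 < ∫ ψ, ρ₁ ψ ∂(μ S φ)) (hI₂ : ∀ φ, 0 < ∫ ψ, ρ₂ ψ ∂(μ S φ))
    (hF : ∀ φ, AEStronglyMeasurable F (μ S φ)) (hb : ∀ φ, ∀ᵐ ψ ∂(μ S φ), |F ψ - F₀| ≤ s) (t : ℝ) (φ : Φ) :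
    |Real.log ((Op S (fun ψ => ((Real.exp (t * F ψ) * ρ₁ ψ : ℝ) : ℂ)) φ).re /
          (Op S (fun ψ => ((Real.exp (t * F ψ) * ρ₂ ψ : ℝ) : ℂ)) φ).re)
        - Real.log ((Op S (fun ψ => (ρ₁ ψ : ℂ)) φ).re / (Op S (fun ψ => (ρ₂ ψ : ℂ)) φ).re)| ≤ 2 * (|t| * s) :=
  abs_log_quotient_sub_le_of_integralOps hOp S φ (hρ₁ φ) (hρ₂ φ) (hρ₁0 φ) (hρ₂0 φ) (hI₁ φ) (hI₂ φ) (hF φ) (hb φ) t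

/-! ## §3 (v1.1, appended) NODE S's END FACE in the B16 fold's operation format -/

open Literature.MathematicalPhysics.QuantumFieldTheory.Balaban1983to89.T4RecentScale (Multiplicity) in
/-- **NODE S's END FACE FOR A LEDGER OF `IntegralOps` QUOTIENTS** (file 5's `qla_of_defect` ∘ §2): a finite ledger `wf` of renormalised
components `X` with scales `sc X ≤ K` and census weights `wt X ≥ 0` satisfying the (0.26)-type census `Multiplicity wf sc wt Cw vol Λ K`
(file 36 ∕ 44 produce it on the cell's tori); per entry an index `S X`, an exterior configuration `φ X`, two real pieces `ρ₁ X, ρ₂ X ≥ 0`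
(`μ (S X) (φ X)`-integrable, positive integrals) and ONE real rider `F X` within `s X` of `F₀ X` a.e., the entry's `t`-constants BEING
the log-quotients of the operation's applications (`hfmt` — the per-entry IDENTITY (α), NODE 00 Stage 5's), and the range bound
`s X ≤ Cd·wt X·(θ^{K − sc X})²` (NODE S's averaging side on the print-kind domains, files 51–53): then
`Spine.NE7.QLa wf sc ct c0 K vol (2·l₀·Cd·Cw) (θ²·Λ)` for every `|t| ≤ l₀` — (QL-a)∣_{U=1}'s profile with `a = θ²Λ` (`= L⁻²` in d = 4).
[folklore] -/
theorem qla_of_integralOps (hOp : IntegralOps Op μ) {D : Type*} {wf : Finset D} {sc : D → ℕ} {wt ct c0 : D → ℝ} {K : ℕ}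
    {l₀ Cd θ t Cw vol Λ : ℝ} (ht : |t| ≤ l₀) (hCd : 0 ≤ Cd) (hwt : ∀ X ∈ wf, 0 ≤ wt X)
    (S : D → Finset LF) (φ : D → Φ) (ρ₁ ρ₂ F : D → Φ → ℝ) (F₀ s : D → ℝ)
    (hρ₁ : ∀ X ∈ wf, Integrable (ρ₁ X) (μ (S X) (φ X))) (hρ₂ : ∀ X ∈ wf, Integrable (ρ₂ X) (μ (S X) (φ X)))
    (hρ₁0 : ∀ X ∈ wf, 0 ≤ᵐ[μ (S X) (φ X)] ρ₁ X) (hρ₂0 : ∀ X ∈ wf, 0 ≤ᵐ[μ (S X) (φ X)] ρ₂ X)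
    (hI₁ : ∀ X ∈ wf, 0 < ∫ ψ, ρ₁ X ψ ∂(μ (S X) (φ X))) (hI₂ : ∀ X ∈ wf, 0 < ∫ ψ, ρ₂ X ψ ∂(μ (S X) (φ X)))
    (hF : ∀ X ∈ wf, AEStronglyMeasurable (F X) (μ (S X) (φ X)))
    (hb : ∀ X ∈ wf, ∀ᵐ ψ ∂(μ (S X) (φ X)), |F X ψ - F₀ X| ≤ s X)
    (hfmt : ∀ X ∈ wf, ct X - c0 X =
      Real.log ((Op (S X) (fun ψ => ((Real.exp (t * F X ψ) * ρ₁ X ψ : ℝ) : ℂ)) (φ X)).re /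
          (Op (S X) (fun ψ => ((Real.exp (t * F X ψ) * ρ₂ X ψ : ℝ) : ℂ)) (φ X)).re)
        - Real.log ((Op (S X) (fun ψ => (ρ₁ X ψ : ℂ)) (φ X)).re / (Op (S X) (fun ψ => (ρ₂ X ψ : ℂ)) (φ X)).re))
    (hs : ∀ X ∈ wf, s X ≤ Cd * wt X * (θ ^ (K - sc X)) ^ 2) (hM : Multiplicity wf sc wt Cw vol Λ K) :
    QLa wf sc ct c0 K vol (2 * l₀ * Cd * Cw) (θ ^ 2 * Λ) := by
  refine qla_of_defect ht hCd hwt (fun X hX => ?_) hM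
  rw [hfmt X hX]
  refine (abs_log_quotient_sub_le_of_integralOps hOp (S X) (φ X) (hρ₁ X hX) (hρ₂ X hX) (hρ₁0 X hX) (hρ₂0 X hX)
    (hI₁ X hX) (hI₂ X hX) (hF X hX) (hb X hX) t).trans ?_
  exact mul_le_mul_of_nonneg_left (mul_le_mul_of_nonneg_left (hs X hX) (abs_nonneg t)) zero_le_two

end Summit.QuantumFields.BalabanUV.T4Continuum.Spine.NE7

end
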